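import Summits.BirchSwinnertonDyer.BirchSwinnertonDyer.Theses.PlecticLegs
import Literature.NumberTheory.EllipticCurves.GaloisAction
import Literature.NumberTheory.EllipticCurves.Tamagawa
import HarnessLib

/-!
# Line `selmer-silencing` for the crux `PlecticLegs.TwistSupply` (stmt-BirchSwinnertonDyer-18260)

Crux (fixed, route `route-BirchSwinnertonDyer-PlecticLegs`, rank 4): for every elliptic `E/ℚ` with
`r = r_an(E) ≥ 2` there are `m` and `H ≤ Gal(ℚ(ζ_m)/ℚ)` with fixed field `F` totally real of degree
`r` such that every non-trivial Dirichlet character `χ mod m` trivial on `H` has `L(E, χ, 1) ≠ 0`.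

Reformulation used by the line: it suffices to produce ONE even Dirichlet character `χ` of exact
order `r` all of whose non-trivial powers `χ^j` have `L(E, χ^j, 1) ≠ 0` ("silent cyclic group of
order `r`"): `H = ker χ`, `F = ℚ(ζ_m)^H` is real (`χ(-1) = 1`) of degree `ord χ = r`, and the
characters of `Gal(F/ℚ)` are exactly the powers of `χ` (`stub_cycloGlue`). The silent cyclic group
is built one prime power at a time (`Nat.recOnPrimePow` on the divisors of `r_an(E)`):

* `stub_goodPrimePowerSupply` — THE LEVER (Selmer silencing + rank-zero converse): for a prime
  `ℓ ≥ 5` of good ORDINARY non-anomalous reduction with surjective `ρ̄_{E,ℓ}`, and every `n ≥ 1`,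
  finite `S`, there is an even `χ` of order `ℓ^n`, conductor prime to `S`, with every `χ^j ≠ 1`
  non-vanishing at `1`. Mechanism: Mazur–Rubin, *Diophantine stability* (Amer. J. Math. 140
  (2018), arXiv:1503.04642), Thm. 48 with Lemma 35 and Lemma `sames`: infinitely many cyclic
  `L/ℚ` of degree `ℓ^n`, split at `S ∪ {ℓ} ∪ {p ∣ N}`, with `Sel(L_i/ℚ, E[ℓ]) = 0` for EVERY layer
  `L_i`, and this group is the classical `λ`-Selmer group of the twist `A_{L_i}`; hence
  `Sel_{λ^∞}(f_E ⊗ χ^j) = 0` for all `χ^j ≠ 1` (`ρ̄_{f⊗χ^j,𝔭} = ρ̄_{E,ℓ}` as `χ ≡ 1 mod 𝔭`). Then the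
  rank-ZERO converse for the twisted newform at `𝔭 ∣ ℓ` — the Iwasawa main-conjecture lower bound
  (Skinner–Urban 2014; or Wan 2015 for `E` over the totally real field `L_i` together with Kato's
  upper bound over `ℚ` and the factorisation `L_p(E/L_i) = ∏_ψ L_p(f ⊗ ψ)`) — gives
  `L(f ⊗ χ^j, 1) ≠ 0`. No hypothesis on `rank E(ℚ)`, on `Ш(E/ℚ)`, or on `L(E,1)`: this is what
  dodges the obstruction (`L(E,1) = 0`) that stops Fearnley–Kisilevsky–Kuwata Thm 1.1, Rohrlich,
  and the first-moment method for fixed order `ℓ ≥ 3`.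
* `stub_residualPrimePowerSupply` — the complementary prime powers `ℓ^n ∣ r_an(E)`:
  `ℓ ∈ {2, 3}`, or `E` not good ordinary / anomalous / small image at `ℓ`. Known sub-case
  `ℓ^n = 2`: Hoffstein–Luo 1997 + root-number parity (tree: `HoffsteinLuo1997_exists_twist_L_one_ne_zero`);
  `ℓ = 3`: Mazur–Rubin's (H.5) fails (`SL₂(𝔽₃)^{ab} = C₃`), needs a repair of their Kummer
  disjointness; supersingular `ℓ`: signed main conjectures (Kobayashi, Sprung, Wan) for the
  converse; reducible `ρ̄`: Greenberg–Vatsal. Honest status: open beyond `ℓ^n = 2`.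
* `stub_multiplyStep` — adjoining a prime power `ℓ^n` coprime to an already silent cyclic group
  `⟨χ₁⟩`: simultaneous Selmer silencing for the finitely many residual modules `E[ℓ] ⊗ χ₁^{-j}`
  (Mazur–Rubin Remark 51-type extension of Larsen's appendix) + the same converse for
  `f ⊗ χ₁^j χ₂^i`.

`TwistSupply_of` (no `sorry`) assembles the four stubs into the crux BY NAME.
-/

set_option linter.dupNamespace false

noncomputable section

open scoped Classical

namespace Summit.BirchSwinnertonDyer.BirchSwinnertonDyer.Cruxes.TwistSupply.SelmerSilencing

open WeierstrassCurve Literature.NumberTheory.EllipticCurves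

/-- `L(W, χ, 1) ≠ 0` in the crux's own phrasing: the entire continuation of `∑ χ(n) aₙ(W) n⁻ˢ`
(agreement on `re s > 2`) does not vanish at `s = 1`. Transparent abbreviation of the clause of
`PlecticLegs.TwistSupply`. -/
abbrev TwistedLOneNeZero (W : WeierstrassCurve ℚ) {m : ℕ} (χ : DirichletCharacter ℂ m) : Prop :=
  ∃ L : ℂ → ℂ, Differentiable ℂ L ∧
    (∀ s : ℂ, 2 < s.re → L s = LSeries (fun n ↦ χ n * ((W.LFunction n : ℤ) : ℂ)) s) ∧ L 1 ≠ 0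

/-- A *silent cyclic group of order `r`* for `W`: an even Dirichlet character `χ` of exact order
`r` all of whose non-trivial powers have non-vanishing twisted central value. -/
abbrev SilentCyclic (W : WeierstrassCurve ℚ) (r : ℕ) : Prop :=
  ∃ (m : ℕ) (_ : NeZero m) (χ : DirichletCharacter ℂ m), χ.Even ∧ orderOf χ = r ∧
    ∀ j : ℕ, χ ^ j ≠ 1 → TwistedLOneNeZero W (χ ^ j)

/-! ### Stubs -/

/-- **Cyclotomic glue** (Mathlib-level Galois theory of `ℚ(ζ_m)`): an even Dirichlet character
`χ mod m` cuts out, as the fixed field of `H = ker χ ≤ Gal(ℚ(ζ_m)/ℚ)`, a totally real field of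
degree `ord χ` whose characters (the characters mod `m` trivial on `H`, in the `μ_m`-phrasing of the
crux) are exactly the powers of `χ`. Size M–L; provable now. -/
theorem stub_cycloGlue :
    ∀ (m : ℕ) [NeZero m] (χ : DirichletCharacter ℂ m), χ.Even →
      ∃ H : Subgroup (CyclotomicField m ℚ ≃ₐ[ℚ] CyclotomicField m ℚ),
        NumberField.IsTotallyReal ↥(IntermediateField.fixedField H) ∧
        Module.finrank ℚ ↥(IntermediateField.fixedField H) = orderOf χ ∧
        ∀ χ' : DirichletCharacter ℂ m,
          (∀ σ ∈ H, ∀ a : ℕ, (∀ z : CyclotomicField m ℚ, z ^ m = 1 → σ z = z ^ a) →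
            χ' (a : ZMod m) = 1) → ∃ j : ℕ, χ' = χ ^ j := by
  sorry

/-- **Good prime-power supply — the lever** (Mazur–Rubin Selmer silencing + rank-zero converse for
the twisted newform; see the module docstring): for `ℓ ≥ 5` prime, `W` good ordinary and
non-anomalous at `ℓ` with surjective mod-`ℓ` representation, every `n ≥ 1` and finite `S`, there is
an even Dirichlet character `χ` of exact order `ℓ ^ n`, level prime to `S`, all of whose non-trivial
powers have `L(W, χ^j, 1) ≠ 0`. Size XL (near-theorem modulo hypothesis matching in
Mazur–Rubin 2018 Thm 48 / Skinner–Urban 2014 / Wan 2015 / Kato 2004). -/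
theorem stub_goodPrimePowerSupply :
    ∀ (W : WeierstrassCurve ℚ) [W.IsElliptic] (ℓ : ℕ) [Fact ℓ.Prime],
      5 ≤ ℓ → W.HasGoodReductionAtPrime ℓ → ¬ (ℓ : ℤ) ∣ W.LFunction ℓ →
      ((W.LFunction ℓ : ℤ) : ZMod ℓ) ≠ 1 → W.HasSurjectiveModNGaloisRep (ℓ : ℤ) →
      ∀ n : ℕ, 1 ≤ n → ∀ S : Finset ℕ,
        ∃ (m : ℕ) (_ : NeZero m) (χ : DirichletCharacter ℂ m),
          (∀ q ∈ S, Nat.Coprime q m) ∧ χ.Even ∧ orderOf χ = ℓ ^ n ∧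
          ∀ j : ℕ, χ ^ j ≠ 1 →
            ∃ L : ℂ → ℂ, Differentiable ℂ L ∧
              (∀ s : ℂ, 2 < s.re →
                L s = LSeries (fun k ↦ (χ ^ j) k * ((W.LFunction k : ℤ) : ℂ)) s) ∧ L 1 ≠ 0 := by
  sorry

/-- **Residual prime-power supply**: the same conclusion for the prime powers `ℓ ^ n` at which the
lever's hypotheses fail (`ℓ < 5`, bad / supersingular / anomalous reduction at `ℓ`, or non-surjective
`ρ̄_{W,ℓ}`); for `ℓ = 2` the parity hypothesis `Even r_an(W)` (root number `+1`) is exactly what an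
even quadratic member needs. Known sub-case `ℓ ^ n = 2` (Hoffstein–Luo 1997 + parity, in tree as a
named fact); open otherwise. Size XL. -/
theorem stub_residualPrimePowerSupply :
    ∀ (W : WeierstrassCurve ℚ) [W.IsElliptic] (ℓ : ℕ) [Fact ℓ.Prime] (n : ℕ), 1 ≤ n →
      (ℓ = 2 → Even W.analyticRank) →
      ¬ (5 ≤ ℓ ∧ W.HasGoodReductionAtPrime ℓ ∧ ¬ (ℓ : ℤ) ∣ W.LFunction ℓ ∧
          ((W.LFunction ℓ : ℤ) : ZMod ℓ) ≠ 1 ∧ W.HasSurjectiveModNGaloisRep (ℓ : ℤ)) →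
        ∃ (m : ℕ) (_ : NeZero m) (χ : DirichletCharacter ℂ m),
          χ.Even ∧ orderOf χ = ℓ ^ n ∧
          ∀ j : ℕ, χ ^ j ≠ 1 →
            ∃ L : ℂ → ℂ, Differentiable ℂ L ∧
              (∀ s : ℂ, 2 < s.re →
                L s = LSeries (fun k ↦ (χ ^ j) k * ((W.LFunction k : ℤ) : ℂ)) s) ∧ L 1 ≠ 0 := by
  sorry

/-- **Multiply step** (adjoin one coprime prime power to a silent cyclic group): if `χ₁` is an even
character of order `a ≥ 2` all of whose non-trivial powers are non-vanishing for `W`, and `ℓ ∤ a`,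
then some even character of order `a · ℓ ^ n` has the same property (intended witness
`χ₁ · χ₂` with `χ₂` of order `ℓ ^ n` and coprime level, chosen by simultaneous Selmer silencing of
the residual modules `E[ℓ] ⊗ χ₁^{-j}` plus the converse for `f ⊗ χ₁^j χ₂^i`). Size XL. -/
theorem stub_multiplyStep :
    ∀ (W : WeierstrassCurve ℚ) [W.IsElliptic] (m₁ : ℕ) [NeZero m₁] (χ₁ : DirichletCharacter ℂ m₁)
      (ℓ n : ℕ), ℓ.Prime → 1 ≤ n → (ℓ = 2 → Even W.analyticRank) →
      χ₁.Even → 2 ≤ orderOf χ₁ → Nat.Coprime (orderOf χ₁) ℓ →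
      (∀ j : ℕ, χ₁ ^ j ≠ 1 →
        ∃ L : ℂ → ℂ, Differentiable ℂ L ∧
          (∀ s : ℂ, 2 < s.re →
            L s = LSeries (fun k ↦ (χ₁ ^ j) k * ((W.LFunction k : ℤ) : ℂ)) s) ∧ L 1 ≠ 0) →
      ∃ (m : ℕ) (_ : NeZero m) (ψ : DirichletCharacter ℂ m),
        ψ.Even ∧ orderOf ψ = orderOf χ₁ * ℓ ^ n ∧
        ∀ j : ℕ, ψ ^ j ≠ 1 →
          ∃ L : ℂ → ℂ, Differentiable ℂ L ∧
            (∀ s : ℂ, 2 < s.re →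
              L s = LSeries (fun k ↦ (ψ ^ j) k * ((W.LFunction k : ℤ) : ℂ)) s) ∧ L 1 ≠ 0 := by
  sorry

/-! ### Stub statements by name

The skeleton gate reads the composition's hypotheses BY NAME: each must be a declared stub. The
`abbrev`s below are the stubs' exact elaborated types (`type_of%`), so `TwistSupply_of` takes
`(h : Statement.stub_<name>)` and nothing else. -/

namespace Statement

/-- Statement of `stub_cycloGlue`. -/
abbrev stub_cycloGlue : Prop := type_of% @SelmerSilencing.stub_cycloGlue
/-- Statement of `stub_goodPrimePowerSupply`. -/
abbrev stub_goodPrimePowerSupply : Prop := type_of% @SelmerSilencing.stub_goodPrimePowerSupply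
/-- Statement of `stub_residualPrimePowerSupply`. -/
abbrev stub_residualPrimePowerSupply : Prop :=
  type_of% @SelmerSilencing.stub_residualPrimePowerSupply
/-- Statement of `stub_multiplyStep`. -/
abbrev stub_multiplyStep : Prop := type_of% @SelmerSilencing.stub_multiplyStep

end Statement

/-! ### Composition -/

/-- The silent cyclic group of order `1`: the trivial character mod `1`. -/
theorem silentCyclic_one (W : WeierstrassCurve ℚ) : SilentCyclic W 1 := by
  refine ⟨1, inferInstance, 1, ?_, orderOf_one, ?_⟩
  · show (1 : DirichletCharacter ℂ 1) (-1) = 1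
    have h : (-1 : ZMod 1) = 1 := Subsingleton.elim _ _
    rw [h, map_one]
  · intro j hj
    exact absurd (one_pow j) hj

/-- Prime-power peeling: every divisor `a` of `r_an(W)` carries a silent cyclic group of order `a`,
by `Nat.recOnPrimePow` from the three supply stubs. -/
theorem silentCyclic_of_dvd
    (hGood : ∀ (W : WeierstrassCurve ℚ) [W.IsElliptic] (ℓ : ℕ) [Fact ℓ.Prime],
      5 ≤ ℓ → W.HasGoodReductionAtPrime ℓ → ¬ (ℓ : ℤ) ∣ W.LFunction ℓ →
      ((W.LFunction ℓ : ℤ) : ZMod ℓ) ≠ 1 → W.HasSurjectiveModNGaloisRep (ℓ : ℤ) →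
      ∀ n : ℕ, 1 ≤ n → ∀ S : Finset ℕ,
        ∃ (m : ℕ) (_ : NeZero m) (χ : DirichletCharacter ℂ m),
          (∀ q ∈ S, Nat.Coprime q m) ∧ χ.Even ∧ orderOf χ = ℓ ^ n ∧
          ∀ j : ℕ, χ ^ j ≠ 1 → TwistedLOneNeZero W (χ ^ j))
    (hRes : ∀ (W : WeierstrassCurve ℚ) [W.IsElliptic] (ℓ : ℕ) [Fact ℓ.Prime] (n : ℕ), 1 ≤ n →
      (ℓ = 2 → Even W.analyticRank) →
      ¬ (5 ≤ ℓ ∧ W.HasGoodReductionAtPrime ℓ ∧ ¬ (ℓ : ℤ) ∣ W.LFunction ℓ ∧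
          ((W.LFunction ℓ : ℤ) : ZMod ℓ) ≠ 1 ∧ W.HasSurjectiveModNGaloisRep (ℓ : ℤ)) →
        ∃ (m : ℕ) (_ : NeZero m) (χ : DirichletCharacter ℂ m),
          χ.Even ∧ orderOf χ = ℓ ^ n ∧ ∀ j : ℕ, χ ^ j ≠ 1 → TwistedLOneNeZero W (χ ^ j))
    (hMul : ∀ (W : WeierstrassCurve ℚ) [W.IsElliptic] (m₁ : ℕ) [NeZero m₁]
      (χ₁ : DirichletCharacter ℂ m₁) (ℓ n : ℕ), ℓ.Prime → 1 ≤ n →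
      (ℓ = 2 → Even W.analyticRank) → χ₁.Even → 2 ≤ orderOf χ₁ → Nat.Coprime (orderOf χ₁) ℓ →
      (∀ j : ℕ, χ₁ ^ j ≠ 1 → TwistedLOneNeZero W (χ₁ ^ j)) →
      ∃ (m : ℕ) (_ : NeZero m) (ψ : DirichletCharacter ℂ m),
        ψ.Even ∧ orderOf ψ = orderOf χ₁ * ℓ ^ n ∧ ∀ j : ℕ, ψ ^ j ≠ 1 → TwistedLOneNeZero W (ψ ^ j))
    (W : WeierstrassCurve ℚ) [W.IsElliptic] (hW : 2 ≤ W.analyticRank) :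
    ∀ a : ℕ, a ∣ W.analyticRank → SilentCyclic W a := by
  intro a
  induction a using Nat.recOnPrimePow with
  | zero =>
    intro h0
    exact absurd (Nat.eq_zero_of_zero_dvd h0) (by omega)
  | one =>
    intro _
    exact silentCyclic_one W
  | prime_pow_mul a p n hp hpa hn ih =>
    intro hdvd
    haveI : Fact p.Prime := ⟨hp⟩
    -- parity: if `p = 2` then `2 ∣ r_an`
    have hpar : p = 2 → Even W.analyticRank := by
      intro h2
      subst h2
      have h2n : 2 ∣ 2 ^ n * a := dvd_mul_of_dvd_left (dvd_pow_self 2 (by omega)) a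
      exact even_iff_two_dvd.mpr (h2n.trans hdvd)
    have hadvd : a ∣ W.analyticRank := (dvd_mul_left a (p ^ n)).trans hdvd
    -- `a ≠ 0`
    have ha0 : a ≠ 0 := by
      rintro rfl
      rw [mul_zero] at hdvd
      exact absurd (Nat.eq_zero_of_zero_dvd hdvd) (by omega)
    by_cases ha1 : a = 1
    · -- a prime power: the two supply stubs
      subst ha1
      rw [mul_one]
      by_cases hgood : (5 ≤ p ∧ W.HasGoodReductionAtPrime p ∧ ¬ (p : ℤ) ∣ W.LFunction p ∧
          ((W.LFunction p : ℤ) : ZMod p) ≠ 1 ∧ W.HasSurjectiveModNGaloisRep (p : ℤ))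
      · obtain ⟨h5, hg, hord, hna, hsurj⟩ := hgood
        obtain ⟨m, hm, χ, -, hev, hordχ, hsil⟩ := hGood W p h5 hg hord hna hsurj n hn ∅
        exact ⟨m, hm, χ, hev, hordχ, hsil⟩
      · obtain ⟨m, hm, χ, hev, hordχ, hsil⟩ := hRes W p n hn hpar hgood
        exact ⟨m, hm, χ, hev, hordχ, hsil⟩
    · -- adjoin the prime power `p ^ n` to a silent cyclic group of order `a ≥ 2`
      have ha2 : 2 ≤ a := by omega
      obtain ⟨m₁, hm₁, χ₁, hev₁, hord₁, hsil₁⟩ := ih hadvd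
      haveI := hm₁
      have hcop : Nat.Coprime (orderOf χ₁) p := by
        rw [hord₁]
        exact ((Nat.Prime.coprime_iff_not_dvd hp).mpr hpa).symm
      have h2 : 2 ≤ orderOf χ₁ := by rw [hord₁]; exact ha2
      obtain ⟨m, hm, ψ, hev, hordψ, hsil⟩ := hMul W m₁ χ₁ p n hp hn hpar hev₁ h2 hcop hsil₁
      refine ⟨m, hm, ψ, hev, ?_, hsil⟩
      rw [hordψ, hord₁, mul_comm]

/-- **Composition**: the four stub statements (by name) imply the crux `PlecticLegs.TwistSupply`
(by name). A silent cyclic group of order `r_an(W)` is built by prime-power peeling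
(`silentCyclic_of_dvd`), and `stub_cycloGlue` turns it into the `(m, H)` of the crux: the fixed field
of `ker χ` is real of degree `ord χ = r_an(W)` and its non-trivial characters are the non-trivial
powers of `χ`. [folklore] -/
theorem TwistSupply_of (hGlue : Statement.stub_cycloGlue) (hGood : Statement.stub_goodPrimePowerSupply)
    (hRes : Statement.stub_residualPrimePowerSupply) (hMul : Statement.stub_multiplyStep) :
    Summit.BirchSwinnertonDyer.BirchSwinnertonDyer.Theses.PlecticLegs.TwistSupply := by
  intro W instW hW
  -- a silent cyclic group of order `r_an(W)`
  obtain ⟨m, hm, χ, hev, hord, hsil⟩ :=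
    silentCyclic_of_dvd hGood hRes hMul W hW W.analyticRank dvd_rfl
  haveI := hm
  -- the fixed field of `ker χ`
  obtain ⟨H, hreal, hdeg, hchar⟩ := hGlue m χ hev
  refine ⟨m, hm, H, hreal, by rw [hdeg, hord], ?_⟩
  intro χ' hχ' hne
  obtain ⟨j, rfl⟩ := hchar χ' hχ'
  exact hsil j hne

/-- The crux along this line, MODULO exactly the four registered stubs (depends on `sorryAx` only
through `stub_*`). [folklore] -/
theorem TwistSupply_proof :
    Summit.BirchSwinnertonDyer.BirchSwinnertonDyer.Theses.PlecticLegs.TwistSupply :=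
  TwistSupply_of stub_cycloGlue stub_goodPrimePowerSupply stub_residualPrimePowerSupply
    stub_multiplyStep

end Summit.BirchSwinnertonDyer.BirchSwinnertonDyer.Cruxes.TwistSupply.SelmerSilencing

end
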